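import Literature.MathematicalPhysics.QuantumManyBody.PeriodicConfigFourier
import Literature.MathematicalPhysics.StatisticalMechanics.PeriodicRieszKernelFourier
import HarnessLib

/-!
# Crux `CorrectorClosure` (stmt-AtomisticToContinuum-12058), line `healing-scale-kac-insertion` —
# cell-Fourier coefficients of the periodised heat kernel

Supports (does not close) stmt-AtomisticToContinuum-12058, route `BECInsertionCorrector`: the
registered sub-goal `cellFourierCoeff_periodizedGaussian` of the heart `stub_kacClosure`.

The Kac insertion operator `K₀ + U_T` sees the bath through the periodised heat kernel
`y ↦ Σ_{n ∈ ℤ³} G_T(y - x - Ln)`, `G_T(z) = (4πT)^{-3/2} e^{-|z|²/4T}`, centred at a bath particle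
`x`. Its `m`-th Fourier coefficient on the cell `[0,L)³` is

  `ĉ_m = L⁻³ e^{-T|2πm/L|²} · conj(e_m(x))`,

i.e. `U_T - ⟨U_T⟩` is a superposition of bath density modes `e^{-2πi m·x_j/L}` damped by the heat
multiplier `e^{-T|p|²}`, `p = 2πm/L`.

Proof: the theta (Poisson summation) identity of the tree,
`Σ_n G_T(z - Ln) = L⁻³ p_{T/L²}(z/L)` with `p_τ = Σ_k e^{-4π²|k|²τ} e_k` the heat kernel of the
unit torus (`ofReal_tsum_heatKernel_sub_latticeVec`, `PeriodicRieszKernelFourier.lean`), so that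
the induced function on `(ℝ/ℤ)³` is `L⁻³ p_{T/L²}(· - x/L)`; the Fourier coefficients of a
translate (`mFourierCoeff_comp_add_right`) and of the torus heat kernel
(`Torus.mFourierCoeff_heatKernelC`: `p̂_τ(m) = e^{-4π²|m|²τ}`).

References: Stein–Weiss (1971), Ch. VII §2 (periodisation of the Gauss kernel); Mathlib
`Analysis.Fourier.AddCircleMulti`.
-/

noncomputable section

open MeasureTheory
open scoped ENNReal NNReal BigOperators ComplexConjugate

namespace Summit.AtomisticToContinuum.BoseEinsteinCondensation.Theorems.CorrectorClosure.HealingScaleKacInsertion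

open Literature.MathematicalPhysics.QuantumManyBody.BoseGas
open Literature.Analysis.UnboundedOperators (heatKernel)
open Literature.Analysis.FunctionSpaces (Torus.heatKernelC Torus.heatCoeff Torus.proj)
open Literature.MathematicalPhysics.StatisticalMechanics (ofReal_tsum_heatKernel_sub_latticeVec)

/-- The normalised Gaussian of the statement is the Gauss–Weierstrass kernel of `ℝ³` at time `T`:
`((4πT)^{3/2})⁻¹ e^{-|z|²/4T} = heatKernel T z`. [folklore] -/
theorem inv_rpow_mul_exp_eq_heatKernel {T : ℝ} (hT : 0 < T) (z : Space) :
    ((4 * Real.pi * T) ^ (3 / 2 : ℝ))⁻¹ * Real.exp (-‖z‖ ^ 2 / (4 * T)) = heatKernel T z := by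
  rw [heatKernel, finrank_euclideanSpace_fin, ← Real.rpow_neg (by positivity)]
  norm_num

/-- **The periodised heat kernel through the unit torus**: for `L, T > 0`,
`Σ_{n ∈ ℤ³} G_T(y - x - Ln) = L⁻³ p_{T/L²}((y - x)/L)` (theta identity). [folklore] -/
theorem ofReal_tsum_gaussian_sub_sub_latticeVec {L T : ℝ} (hL : 0 < L) (hT : 0 < T) (x y : Space) :
    ((∑' n : Fin 3 → ℤ, ((4 * Real.pi * T) ^ (3 / 2 : ℝ))⁻¹ *
        Real.exp (-‖y - x - latticeVec L n‖ ^ 2 / (4 * T)) : ℝ) : ℂ) =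
      (((L ^ 3)⁻¹ : ℝ) : ℂ) * Torus.heatKernelC (T / L ^ 2) (Torus.proj (L⁻¹ • (y - x))) := by
  rw [← ofReal_tsum_heatKernel_sub_latticeVec hL hT (y - x)]
  simp only [inv_rpow_mul_exp_eq_heatKernel hT]

/-- The covering map of the tree's flat torus at `z/L` is the cell's `toUnitTorus L z`. [folklore] -/
theorem proj_inv_smul_eq_toUnitTorus (L : ℝ) (z : Space) :
    Torus.proj (L⁻¹ • z) = toUnitTorus L z := by
  funext i
  rw [Literature.Analysis.FunctionSpaces.Torus.proj_smul_apply]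
  simp only [toUnitTorus, inv_mul_eq_div]

/-- `x ↦ x/L mod ℤ³` is compatible with subtraction. [folklore] -/
theorem toUnitTorus_sub (L : ℝ) (x y : Space) :
    toUnitTorus L (x - y) = toUnitTorus L x - toUnitTorus L y := by
  funext k
  simp only [toUnitTorus, Pi.sub_apply, PiLp.sub_apply, sub_div, AddCircle.coe_sub]

/-- `e_m(-a) = conj(e_m(x))` for `a = x/L mod ℤ³`. [folklore] -/
theorem mFourier_neg_toUnitTorus (L : ℝ) (m : Fin 3 → ℤ) (x : Space) :
    UnitAddTorus.mFourier m (-toUnitTorus L x) = conj (cellWave L m x) := by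
  have h := mFourier_neg_apply_neg (-m) (toUnitTorus L x)
  rw [neg_neg] at h
  rw [h, conj_cellWave]
  rfl

/-- **Cell-Fourier coefficients of the periodised heat kernel centred at `x`** (registered
sub-goal `cellFourierCoeff_periodizedGaussian` of `stub_kacClosure`): for `L, T > 0`, `x ∈ ℝ³` and
`m ∈ ℤ³`, the `m`-th coefficient on `[0,L)³` of `y ↦ Σ_{n ∈ ℤ³} (4πT)^{-3/2} e^{-|y - x - Ln|²/4T}`
is `L⁻³ e^{-T(2π/L)²|m|²} conj(e_m(x))`. [folklore] -/
theorem cellFourierCoeff_periodizedGaussian (L : ℝ) (hL : 0 < L) (T : ℝ) (hT : 0 < T) (x : Space)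
    (m : Fin 3 → ℤ) :
    cellFourierCoeff L (fun y : Space => ((∑' n : Fin 3 → ℤ,
        ((4 * Real.pi * T) ^ (3 / 2 : ℝ))⁻¹ * Real.exp (-‖y - x - latticeVec L n‖ ^ 2 / (4 * T)) : ℝ) : ℂ))
        m =
      (((L ^ 3)⁻¹ * Real.exp (-(T * ((2 * Real.pi / L) ^ 2 * ∑ i, (m i : ℝ) ^ 2))) : ℝ) : ℂ) *
        conj (cellWave L m x) := by
  have hτ : 0 < T / L ^ 2 := by positivity
  -- the induced function on the unit torus is `L⁻³ p_{T/L²}(· - x/L)`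
  have htf : torusFun L (fun y : Space => ((∑' n : Fin 3 → ℤ,
      ((4 * Real.pi * T) ^ (3 / 2 : ℝ))⁻¹ * Real.exp (-‖y - x - latticeVec L n‖ ^ 2 / (4 * T)) : ℝ) : ℂ)) =
      (((L ^ 3)⁻¹ : ℝ) : ℂ) • fun t : UnitAddTorus (Fin 3) =>
        Torus.heatKernelC (T / L ^ 2) (t + -toUnitTorus L x) := by
    funext t
    simp only [torusFun, Pi.smul_apply, smul_eq_mul]
    rw [ofReal_tsum_gaussian_sub_sub_latticeVec hL hT, proj_inv_smul_eq_toUnitTorus, toUnitTorus_sub,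
      toUnitTorus_fromUnitTorus hL.ne', sub_eq_add_neg]
  unfold cellFourierCoeff
  rw [htf, Literature.Analysis.FunctionSpaces.Torus.mFourierCoeff_const_smul,
    mFourierCoeff_comp_add_right,
    Literature.Analysis.FunctionSpaces.Torus.mFourierCoeff_heatKernelC hτ, mFourier_neg_toUnitTorus,
    Literature.Analysis.FunctionSpaces.Torus.heatCoeff_apply, smul_eq_mul]
  have hexp : Real.exp (-(4 * Real.pi ^ 2 * Literature.Analysis.FunctionSpaces.Torus.freqNormSq m *
      (T / L ^ 2))) = Real.exp (-(T * ((2 * Real.pi / L) ^ 2 * ∑ i, (m i : ℝ) ^ 2))) := by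
    unfold Literature.Analysis.FunctionSpaces.Torus.freqNormSq
    congr 1
    field_simp
    ring
  rw [hexp]
  push_cast
  ring

end Summit.AtomisticToContinuum.BoseEinsteinCondensation.Theorems.CorrectorClosure.HealingScaleKacInsertion

end
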